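import Literature.Geometry.Kaehler.ComplexTorusIntegralHodgeClassesRank
import Literature.Geometry.Kaehler.ComplexTorusPoincareDuality
import HarnessLib

/-!
# The transcendental lattice in every degree: the annihilator `T^{l}_{k,p}(X) ⊆ Hˡ(X, ℤ)` of the integral Hodge classes `Hdg^{k,p}(X, ℤ)`
# under the cup-product pairing `Hᵏ(X, ℤ) × Hˡ(X, ℤ) → ℤ` (`k + l = 2g`) has rank `C(2g, l) − rk_ℤ Hdg^{k,p}(X, ℤ)`

Layer `Literature/Geometry/Kaehler`, namespace `Literature.Geometry.Kaehler.ComplexTorus`; lane `lit-hodgefound` (Track 2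
foundations library), seat p09, generation 31, row g31-#11. THEOREMS ONLY (0 definitions); no named fact, net debt 0. For a complex torus
`X = E/Φ(ℤ^ι)`, `|ι| = 2g`, an enumeration `e : Fin n ≃ ι` and complementary degrees `h : k + l = n`, the tree's cup-product pairing
`⟨γ, δ⟩ = (γ ∧ δ)(λ_{e 0}, …, λ_{e(n−1)})` (`poincarePairing Φ e h`, `ComplexTorusPoincareDuality`; Lange 2023 §6.2.4 p. 310: "Poincaré
duality `Hᵖ(X, ℤ) ⥲ H^{2g−p}(X, ℤ)^*`"; perfect over `ℚ`: the tree's instance `poincarePairingRat_isPerfPair`) and the integral Hodge classes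
`Hdg^{k,p}(X, ℤ) = Hᵏ(X, ℤ) ∩ Λ^{p,p}` (A4-23), the ANNIHILATOR

  `T := Hˡ(X, ℤ) ∩ ⋂_{s ∈ Hdg^{k,p}(X, ℤ)} ker ⟨s, ·⟩ = integralForms Φ l ⊓ ⨅_{s} (ker ⟨s, ·⟩).toAddSubgroup`

(written out, no definition) is the degree-`l` TRANSCENDENTAL LATTICE: for `k = l = 2p = g` it is the tree's `T = Hdg^⊥ ⊂ H^{2p}(X, ℤ)`
of rows g30-#4…#9 (`B.orthogonal (toIntSubmodule (Hdg.addSubgroupOf H^{2p}(X, ℤ)))`; Huybrechts Ch. 3 §2.2–2.3: "the transcendental lattice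
… `T(X) = NS(X)^⊥`"; Shioda–Mitani's `T_X`), see `mem_integralHodgeAnnihilator_iff_mem_orthogonal_hodgeSublattice` (the declaration names use the stem `integralHodgeAnnihilator`,
since `transcendentalLattice` / `transcendentalPart` name p18's `p = 1` lattice of an abelian surface and its Hodge structure). This file
proves, in every degree:

* §1 membership; `T` annihilates all of `B^{k,p}(X) = ℚ · Hdg^{k,p}(X, ℤ)`; `T` is saturated in `Hˡ(X, ℤ)`.
* §2 `ℚ · T` is the annihilator of `B^{k,p}(X)` in `Hˡ(X, ℚ)` (rational annihilated classes have integral multiples in `T`).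
* §3 **`rk_ℤ T = C(|ι|, l) − rk_ℤ Hdg^{k,p}(X, ℤ)`** (`= b_l(X) − ρ_{k,p}(X)`): Poincaré duality over `ℚ` is perfect, so the annihilator of the
  `dim_ℚ B^{k,p}`-dimensional subspace `B^{k,p} ⊆ Hᵏ(X, ℚ)` has dimension `b_l − dim B^{k,p}` in `Hˡ(X, ℚ)` (Mathlib's
  `Subspace.finrank_add_finrank_dualCoannihilator_eq`), and `rk_ℤ T = dim_ℚ (ℚ · T)` (g31-#10's `finrank_int_eq_finrank_span_rat_of_le_integralForms`,
  re-derived privately here), `rk_ℤ Hdg = dim_ℚ B` (g30-#9). The middle-degree case is g30-#9's `finrank_orthogonal_hodgeSublattice_eq`.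

## Contents (theorems only)

* §1 **`mem_integralHodgeAnnihilator_iff`**, `integralHodgeAnnihilator_le_integralForms`, **`poincarePairing_eq_zero_of_mem_hodgeClassesIn_of_mem_integralHodgeAnnihilator`**,
  `mem_integralHodgeAnnihilator_of_smul_mem` (saturated), `mem_integralHodgeAnnihilator_iff_mem_orthogonal_hodgeSublattice` (middle degree = the tree's `T`).
* §2 `smul_mem_integralHodgeAnnihilator_of_mem_rationalForms`, **`span_rat_integralHodgeAnnihilator_eq`**.
* §3 **`finrank_integralHodgeAnnihilator_eq`** (`rk T = C(|ι|, l) − rk Hdg^{k,p}(X, ℤ)`), `finrank_integralHodgeAnnihilator_add_finrank_integralHodgeClassesIn`.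

## References

* [cite: Lange2023AbelianVarietiesComplex, §6.2.4 (p. 310: Poincaré duality `Hᵖ(X, ℤ) ⥲ H^{2g−p}(X, ℤ)^*`); §7.2.2]
* [cite: Huybrechts2016K3, Ch. 3 §2.2–2.3 (PDF pp. 58–59: `T(X) = NS(X)^⊥`, "transcendental lattice"); Ch. 14 §0.1 (PDF p. 333)]
* [cite: ShiodaMitani1974, §3 (3.19) (`X ↦ T_X`)]
* [cite: Ebeling1994, §1.1 before Prop. 1.2 (`K^⊥ = {y ∈ Γ | x·y = 0 ∀ x ∈ K}`)]
-/

noncomputable section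

open Module Function

namespace Literature.Geometry.Kaehler.ComplexTorus

section TranscendentalAllDegrees

variable {ι : Type*} [Fintype ι] [DecidableEq ι] {E : Type*} [NormedAddCommGroup E] [NormedSpace ℂ E]
  (Φ : (ι → ℝ) ≃L[ℝ] E) {n k l : ℕ} (e : Fin n ≃ ι) (h : k + l = n) (p : ℕ)

/-! ## §1 The annihilator `T ⊆ Hˡ(X, ℤ)` of `Hdg^{k,p}(X, ℤ)`: membership, saturation, middle degree -/

omit [Fintype ι] in
/-- Membership in the degree-`l` transcendental lattice: `x ∈ T ⟺ x ∈ Hˡ(X, ℤ) ∧ ∀ s ∈ Hdg^{k,p}(X, ℤ), ⟨s, x⟩ = 0`.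
[cite: Huybrechts2016K3, Ch. 3 §2.2 (PDF p. 58)] [cite: Ebeling1994, §1.1 before Prop. 1.2] -/
theorem mem_integralHodgeAnnihilator_iff {x : E [⋀^Fin l]→L[ℝ] ℂ} :
    x ∈ integralForms Φ l ⊓ ⨅ s : integralHodgeClassesIn Φ k p,
        (LinearMap.ker (poincarePairing Φ e h (s : E [⋀^Fin k]→L[ℝ] ℂ))).toAddSubgroup ↔
      x ∈ integralForms Φ l ∧ ∀ s ∈ integralHodgeClassesIn Φ k p, poincarePairing Φ e h s x = 0 := by
  simp only [AddSubgroup.mem_inf, AddSubgroup.mem_iInf, Submodule.mem_toAddSubgroup, LinearMap.mem_ker, Subtype.forall]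

omit [Fintype ι] in
/-- `T ⊆ Hˡ(X, ℤ)`. [cite: Huybrechts2016K3, Ch. 3 §2.2 (PDF p. 58)] -/
theorem integralHodgeAnnihilator_le_integralForms :
    integralForms Φ l ⊓ ⨅ s : integralHodgeClassesIn Φ k p,
        (LinearMap.ker (poincarePairing Φ e h (s : E [⋀^Fin k]→L[ℝ] ℂ))).toAddSubgroup ≤ integralForms Φ l :=
  inf_le_left

/-- **`T` annihilates every rational Hodge class**: `⟨s, x⟩ = 0` for `s ∈ B^{k,p}(X) = ℚ · Hdg^{k,p}(X, ℤ)` and `x ∈ T` (`⟨·, x⟩` is linear and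
`B^{k,p}` is spanned by its integral points, the tree's `hodgeClassesIn_eq_span_integralHodgeClassesIn`).
[cite: Lange2023AbelianVarietiesComplex, §7.2.2 and §6.2.4 (p. 310)] -/
theorem poincarePairing_eq_zero_of_mem_hodgeClassesIn_of_mem_integralHodgeAnnihilator {x : E [⋀^Fin l]→L[ℝ] ℂ}
    (hx : x ∈ integralForms Φ l ⊓ ⨅ s : integralHodgeClassesIn Φ k p,
        (LinearMap.ker (poincarePairing Φ e h (s : E [⋀^Fin k]→L[ℝ] ℂ))).toAddSubgroup)
    {s : E [⋀^Fin k]→L[ℝ] ℂ} (hs : s ∈ hodgeClassesIn Φ k p) : poincarePairing Φ e h s x = 0 := by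
  classical
  letI : LinearOrder ι := LinearOrder.lift' (Fintype.equivFin ι) (Fintype.equivFin ι).injective
  rw [mem_integralHodgeAnnihilator_iff] at hx
  rw [hodgeClassesIn_eq_span_integralHodgeClassesIn] at hs
  induction hs using Submodule.span_induction with
  | mem s hs => exact hx.2 s hs
  | zero => rw [map_zero, LinearMap.zero_apply]
  | add s t _ _ ihs iht => rw [map_add, LinearMap.add_apply, ihs, iht, add_zero]
  | smul q s _ ih => rw [← Rat.cast_smul_eq_qsmul ℂ q, map_smul, LinearMap.smul_apply, ih, smul_zero]

omit [Fintype ι] in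
/-- **`T` is saturated in `Hˡ(X, ℤ)`**: `c · x ∈ T`, `c ≠ 0`, `x ∈ Hˡ(X, ℤ)` `⟹` `x ∈ T` (`⟨s, c x⟩ = c ⟨s, x⟩`).
[cite: Huybrechts2016K3, Ch. 14 §0.1 (PDF p. 333)] -/
theorem mem_integralHodgeAnnihilator_of_smul_mem {c : ℂ} (hc : c ≠ 0) {x : E [⋀^Fin l]→L[ℝ] ℂ} (hxZ : x ∈ integralForms Φ l)
    (hcx : c • x ∈ integralForms Φ l ⊓ ⨅ s : integralHodgeClassesIn Φ k p,
        (LinearMap.ker (poincarePairing Φ e h (s : E [⋀^Fin k]→L[ℝ] ℂ))).toAddSubgroup) :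
    x ∈ integralForms Φ l ⊓ ⨅ s : integralHodgeClassesIn Φ k p,
        (LinearMap.ker (poincarePairing Φ e h (s : E [⋀^Fin k]→L[ℝ] ℂ))).toAddSubgroup := by
  rw [mem_integralHodgeAnnihilator_iff] at hcx ⊢
  refine ⟨hxZ, fun s hs ↦ ?_⟩
  have h1 := hcx.2 s hs
  rw [map_smul, smul_eq_mul, mul_eq_zero] at h1
  exact h1.resolve_left hc

omit [Fintype ι] in
/-- **Middle degree: `T` is the tree's transcendental lattice `Hdg^⊥ ⊂ H^{2p}(X, ℤ)`** of rows g30-#4…#9 (membership agrees with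
`mem_orthogonal_hodgeSublattice_iff` for any `ℤ`-form `B` agreeing with `⟨ , ⟩`). [cite: Huybrechts2016K3, Ch. 3 §2.2–2.3 (PDF pp. 58–59)] [cite: ShiodaMitani1974, §3 (3.19)] -/
theorem mem_integralHodgeAnnihilator_iff_mem_orthogonal_hodgeSublattice {g : ℕ} (e₂ : Fin (2 * g) ≃ ι) (h₂ : 2 * p + 2 * p = 2 * g)
    {B : LinearMap.BilinForm ℤ (integralForms Φ (2 * p))}
    (hB : ∀ x y : integralForms Φ (2 * p), ((B x y : ℤ) : ℂ) =
      poincarePairing Φ e₂ h₂ (x : E [⋀^Fin (2 * p)]→L[ℝ] ℂ) (y : E [⋀^Fin (2 * p)]→L[ℝ] ℂ))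
    (x : integralForms Φ (2 * p)) :
    (x : E [⋀^Fin (2 * p)]→L[ℝ] ℂ) ∈ integralForms Φ (2 * p) ⊓ ⨅ s : integralHodgeClassesIn Φ (2 * p) p,
        (LinearMap.ker (poincarePairing Φ e₂ h₂ (s : E [⋀^Fin (2 * p)]→L[ℝ] ℂ))).toAddSubgroup ↔
      x ∈ B.orthogonal (AddSubgroup.toIntSubmodule ((integralHodgeClasses Φ p).addSubgroupOf (integralForms Φ (2 * p)))) := by
  rw [mem_integralHodgeAnnihilator_iff, mem_orthogonal_hodgeSublattice_iff Φ e₂ h₂ hB]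
  exact ⟨fun hx ↦ hx.2, fun hx ↦ ⟨x.2, hx⟩⟩

/-! ## §2 `ℚ · T` is the annihilator of `B^{k,p}(X)` in `Hˡ(X, ℚ)` -/

/-- A RATIONAL class annihilated by `Hdg^{k,p}(X, ℤ)` has a positive integral multiple in `T` (clear denominators,
`exists_nsmul_mem_integralForms`). [cite: Lange2023AbelianVarietiesComplex, §1.1.3 Exercise 1.1.6 (8) and §7.2.2] -/
theorem exists_nsmul_mem_integralHodgeAnnihilator_of_mem_rationalForms {y : E [⋀^Fin l]→L[ℝ] ℂ} (hyQ : y ∈ rationalForms Φ l)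
    (hy : ∀ s ∈ integralHodgeClassesIn Φ k p, poincarePairing Φ e h s y = 0) :
    ∃ N : ℕ, 0 < N ∧ (N : ℂ) • y ∈ integralForms Φ l ⊓ ⨅ s : integralHodgeClassesIn Φ k p,
        (LinearMap.ker (poincarePairing Φ e h (s : E [⋀^Fin k]→L[ℝ] ℂ))).toAddSubgroup := by
  classical
  letI : LinearOrder ι := LinearOrder.lift' (Fintype.equivFin ι) (Fintype.equivFin ι).injective
  obtain ⟨N, hN, hNy⟩ := exists_nsmul_mem_integralForms Φ hyQ
  refine ⟨N, hN, (mem_integralHodgeAnnihilator_iff Φ e h p).2 ⟨hNy, fun s hs ↦ ?_⟩⟩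
  rw [map_smul, hy s hs, smul_zero]

/-- **`ℚ · T = {y ∈ Hˡ(X, ℚ) : ⟨Hdg^{k,p}(X, ℤ), y⟩ = 0}`**: the `ℚ`-span of the transcendental lattice is the annihilator of the Hodge
classes in rational cohomology. [cite: Huybrechts2016K3, Ch. 3 §2.2 (PDF p. 58)] [cite: Lange2023AbelianVarietiesComplex, §6.2.4 (p. 310) and §7.2.2] -/
theorem span_rat_integralHodgeAnnihilator_eq :
    Submodule.span ℚ ((integralForms Φ l ⊓ ⨅ s : integralHodgeClassesIn Φ k p,
        (LinearMap.ker (poincarePairing Φ e h (s : E [⋀^Fin k]→L[ℝ] ℂ))).toAddSubgroup :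
          AddSubgroup (E [⋀^Fin l]→L[ℝ] ℂ)) : Set (E [⋀^Fin l]→L[ℝ] ℂ)) =
      rationalForms Φ l ⊓ ⨅ s : integralHodgeClassesIn Φ k p,
        (LinearMap.ker (poincarePairing Φ e h (s : E [⋀^Fin k]→L[ℝ] ℂ))).restrictScalars ℚ := by
  refine le_antisymm (Submodule.span_le.2 fun x hx ↦ ?_) fun y hy ↦ ?_
  · have hx' := (mem_integralHodgeAnnihilator_iff Φ e h p).1 hx
    simp only [SetLike.mem_coe, Submodule.mem_inf, Submodule.mem_iInf, Submodule.restrictScalars_mem, LinearMap.mem_ker,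
      Subtype.forall]
    exact ⟨mem_rationalForms_of_mem_integralForms Φ hx'.1, hx'.2⟩
  · simp only [Submodule.mem_inf, Submodule.mem_iInf, Submodule.restrictScalars_mem, LinearMap.mem_ker, Subtype.forall] at hy
    obtain ⟨N, hN, hNy⟩ := exists_nsmul_mem_integralHodgeAnnihilator_of_mem_rationalForms Φ e h p hy.1 hy.2
    have key : y = (N : ℚ)⁻¹ • ((N : ℂ) • y) := by
      rw [← Rat.cast_smul_eq_qsmul ℂ, smul_smul, Rat.cast_inv, Rat.cast_natCast,
        inv_mul_cancel₀ (by exact_mod_cast hN.ne' : (N : ℂ) ≠ 0), one_smul]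
    rw [key]
    exact Submodule.smul_mem _ _ (Submodule.subset_span hNy)

/-! ## §3 `rk_ℤ T = C(|ι|, l) − rk_ℤ Hdg^{k,p}(X, ℤ)` -/

omit [DecidableEq ι] in
/-- `rk_ℤ S = dim_ℚ (ℚ · S)` for a subgroup `S` of the lattice `Hˡ(X, ℤ)` (g31-#10's `finrank_int_eq_finrank_span_rat_of_le_integralForms`,
re-derived here so that this file depends only on the middle-lattice and duality files; a `ℤ`-basis of `S` stays `ℚ`-free,
`LinearIndependent.iff_fractionRing`). [cite: Lange2023AbelianVarietiesComplex, §1.1.3 Exercise 1.1.6 (8)] -/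
private theorem finrank_int_eq_finrank_span_rat_aux {m : ℕ} (S : AddSubgroup (E [⋀^Fin m]→L[ℝ] ℂ))
    (hS : S ≤ integralForms Φ m) :
    finrank ℤ S = finrank ℚ (Submodule.span ℚ (S : Set (E [⋀^Fin m]→L[ℝ] ℂ))) := by
  classical
  haveI := finite_integralForms Φ m
  haveI := free_integralForms Φ m
  let j : S →ₗ[ℤ] AddSubgroup.toIntSubmodule (integralForms Φ m) := (AddSubgroup.inclusion hS).toIntLinearMap
  have hj : Injective j := AddSubgroup.inclusion_injective hS
  haveI : Module.Finite ℤ S := Module.Finite.of_injective j hj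
  haveI : Module.IsTorsionFree ℤ S := Function.Injective.moduleIsTorsionFree j hj (map_smul j)
  let b := Module.finBasis ℤ S
  let L : S →ₗ[ℤ] (E [⋀^Fin m]→L[ℝ] ℂ) := S.subtype.toIntLinearMap
  have hL : Injective L := Subtype.coe_injective
  have hgZ : LinearIndependent ℤ (L ∘ b) := b.linearIndependent.map' L (LinearMap.ker_eq_bot.2 hL)
  have hgQ : LinearIndependent ℚ (L ∘ b) := (LinearIndependent.iff_fractionRing ℤ ℚ).1 hgZ
  have hspan : Submodule.span ℚ (Set.range (L ∘ b)) = Submodule.span ℚ (S : Set (E [⋀^Fin m]→L[ℝ] ℂ)) := by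
    refine le_antisymm (Submodule.span_mono ?_) (Submodule.span_le.2 ?_)
    · rintro _ ⟨i, rfl⟩
      exact (b i).2
    · rintro γ hγ
      have hγ' : γ = L ⟨γ, hγ⟩ := rfl
      rw [hγ', ← b.sum_repr ⟨γ, hγ⟩, map_sum]
      refine Submodule.sum_mem _ fun i _ ↦ ?_
      rw [map_smul]
      exact Submodule.smul_of_tower_mem _ _ (Submodule.subset_span ⟨i, rfl⟩)
  rw [← hspan, finrank_span_eq_card hgQ, Fintype.card_fin]

/-- **The dimension of the rational annihilator**: `dim_ℚ {y ∈ Hˡ(X, ℚ) : ⟨B^{k,p}, y⟩ = 0} = C(|ι|, l) − dim_ℚ B^{k,p}(X)` — Poincaré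
duality over `ℚ` is a perfect pairing `Hᵏ(X, ℚ) × Hˡ(X, ℚ) → ℚ` (the tree's `poincarePairingRat_isPerfPair`), so the annihilator of a subspace
`W ⊆ Hᵏ(X, ℚ)` has codimension `dim W` (Mathlib's `Subspace.finrank_add_finrank_dualCoannihilator_eq`).
[cite: Lange2023AbelianVarietiesComplex, §6.2.4 (p. 310) and §1.1.3 Exercise 1.1.6 (8)] -/
theorem finrank_rationalAnnihilator_add_finrank_hodgeClassesIn :
    finrank ℚ ↥(rationalForms Φ l ⊓ ⨅ s : integralHodgeClassesIn Φ k p,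
        (LinearMap.ker (poincarePairing Φ e h (s : E [⋀^Fin k]→L[ℝ] ℂ))).restrictScalars ℚ : Submodule ℚ (E [⋀^Fin l]→L[ℝ] ℂ)) +
      finrank ℚ (hodgeClassesIn Φ k p) = (Fintype.card ι).choose l := by
  classical
  letI : LinearOrder ι := LinearOrder.lift' (Fintype.equivFin ι) (Fintype.equivFin ι).injective
  haveI := finiteDimensional_rationalForms Φ k
  haveI := finiteDimensional_rationalForms Φ l
  -- the rational annihilator inside the subtype `Hˡ(X, ℚ)`, as a dual co-annihilator
  set BQ : Submodule ℚ (rationalForms Φ k) := (hodgeClassesIn Φ k p).comap (rationalForms Φ k).subtype with hBQ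
  set V' : Submodule ℚ (rationalForms Φ l) := (BQ.map (poincarePairingRat Φ e h (k := k) (l := l))).dualCoannihilator with hV'
  have hle : hodgeClassesIn Φ k p ≤ rationalForms Φ k := fun _ hγ ↦ hγ.1
  -- (a) its image in `Hˡ(X, ℂ)` is the annihilator of the statement
  have hmap : V'.map (rationalForms Φ l).subtype =
      (rationalForms Φ l ⊓ ⨅ s : integralHodgeClassesIn Φ k p,
        (LinearMap.ker (poincarePairing Φ e h (s : E [⋀^Fin k]→L[ℝ] ℂ))).restrictScalars ℚ) := by
    ext y
    simp only [Submodule.mem_map, Submodule.subtype_apply, Submodule.mem_inf, Submodule.mem_iInf,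
      Submodule.restrictScalars_mem, LinearMap.mem_ker, Subtype.forall]
    constructor
    · rintro ⟨y', hy', rfl⟩
      refine ⟨y'.2, fun s hs ↦ ?_⟩
      have hsQ : s ∈ rationalForms Φ k := (integralHodgeClassesIn_subset_hodgeClassesIn Φ k p hs).1
      have h1 : poincarePairingRat Φ e h ⟨s, hsQ⟩ y' = 0 := by
        rw [hV', Submodule.mem_dualCoannihilator] at hy'
        exact hy' (poincarePairingRat Φ e h ⟨s, hsQ⟩) (Submodule.mem_map_of_mem
          (show (⟨s, hsQ⟩ : rationalForms Φ k) ∈ BQ from integralHodgeClassesIn_subset_hodgeClassesIn Φ k p hs))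
      have h2 := congrArg (fun q : ℚ ↦ (q : ℂ)) h1
      simpa only [coe_poincarePairingRat, Rat.cast_zero] using h2
    · rintro ⟨hyQ, hy⟩
      refine ⟨⟨y, hyQ⟩, ?_, rfl⟩
      rw [hV', Submodule.mem_dualCoannihilator]
      intro φ hφ
      obtain ⟨s, hs, rfl⟩ := Submodule.mem_map.1 hφ
      have h0 : poincarePairing Φ e h (s : E [⋀^Fin k]→L[ℝ] ℂ) y = 0 := by
        -- `⟨s, y⟩ = 0` for the rational Hodge class `s`, by linearity from the integral Hodge classes
        have hs' : (s : E [⋀^Fin k]→L[ℝ] ℂ) ∈ hodgeClassesIn Φ k p := hs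
        rw [hodgeClassesIn_eq_span_integralHodgeClassesIn] at hs'
        refine Submodule.span_induction (p := fun t _ ↦ poincarePairing Φ e h t y = 0) (fun t ht ↦ hy t ht) ?_ ?_ ?_ hs'
        · rw [map_zero, LinearMap.zero_apply]
        · intro t u _ _ iht ihu
          rw [map_add, LinearMap.add_apply, iht, ihu, add_zero]
        · intro q t _ ih
          rw [← Rat.cast_smul_eq_qsmul ℂ q, map_smul, LinearMap.smul_apply, ih, smul_zero]
      have h1 : ((poincarePairingRat Φ e h s ⟨y, hyQ⟩ : ℚ) : ℂ) = 0 := by rw [coe_poincarePairingRat]; exact h0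
      exact_mod_cast h1
  -- (b) dimensions
  have hdimV : finrank ℚ (V'.map (rationalForms Φ l).subtype) = finrank ℚ V' :=
    (Submodule.equivMapOfInjective _ (rationalForms Φ l).injective_subtype V').finrank_eq.symm
  have hI : LinearMap.IsPerfPair (M := rationalForms Φ k) (N := rationalForms Φ l) (poincarePairingRat Φ e h) :=
    inferInstance
  have hinjP : Injective (poincarePairingRat Φ e h (k := k) (l := l)) := hI.bijective_left.1
  have hdimB : finrank ℚ (BQ.map (poincarePairingRat Φ e h (k := k) (l := l))) = finrank ℚ (hodgeClassesIn Φ k p) := by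
    rw [← (Submodule.equivMapOfInjective _ hinjP BQ).finrank_eq, hBQ]
    exact (Submodule.comapSubtypeEquivOfLe hle).finrank_eq
  have hsum := Subspace.finrank_add_finrank_dualCoannihilator_eq (K := ℚ) (V := ↥(rationalForms Φ l))
    (BQ.map (poincarePairingRat Φ e h (k := k) (l := l)))
  rw [← hmap, hdimV, ← hdimB, add_comm, hV', ← finrank_rationalForms_eq_choose Φ l]
  exact hsum

/-- **`rk_ℤ T + rk_ℤ Hdg^{k,p}(X, ℤ) = C(|ι|, l) = b_l(X)`** for the degree-`l` transcendental lattice `T` (`k + l = |ι| = 2 dim X`).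
[cite: Huybrechts2016K3, Ch. 3 §2.3 (PDF p. 59: "rank `6 − ρ`" for abelian surfaces) and Ch. 14 §0.1] [cite: Lange2023AbelianVarietiesComplex, §6.2.4 (p. 310) and §7.2.2] -/
theorem finrank_integralHodgeAnnihilator_add_finrank_integralHodgeClassesIn :
    finrank ℤ ↥(integralForms Φ l ⊓ ⨅ s : integralHodgeClassesIn Φ k p,
        (LinearMap.ker (poincarePairing Φ e h (s : E [⋀^Fin k]→L[ℝ] ℂ))).toAddSubgroup) +
      finrank ℤ (integralHodgeClassesIn Φ k p) = (Fintype.card ι).choose l := by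
  rw [finrank_int_eq_finrank_span_rat_aux Φ _ (integralHodgeAnnihilator_le_integralForms Φ e h p),
    span_rat_integralHodgeAnnihilator_eq, finrank_integralHodgeClassesIn_eq_finrank_hodgeClassesIn]
  exact finrank_rationalAnnihilator_add_finrank_hodgeClassesIn Φ e h p

/-- **`rk_ℤ T = C(|ι|, l) − rk_ℤ Hdg^{k,p}(X, ℤ)`**: the rank of the degree-`l` transcendental lattice (middle degree: g30-#9's
`finrank_orthogonal_hodgeSublattice_eq`, "`rk T = C(2g, 2p) − dim_ℚ Bᵖ(X)`"). [cite: Huybrechts2016K3, Ch. 3 §2.3 (PDF p. 59)] [cite: Lange2023AbelianVarietiesComplex, §6.2.4 (p. 310) and §7.2.2] -/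
theorem finrank_integralHodgeAnnihilator_eq :
    finrank ℤ ↥(integralForms Φ l ⊓ ⨅ s : integralHodgeClassesIn Φ k p,
        (LinearMap.ker (poincarePairing Φ e h (s : E [⋀^Fin k]→L[ℝ] ℂ))).toAddSubgroup) =
      (Fintype.card ι).choose l - finrank ℤ (integralHodgeClassesIn Φ k p) := by
  have h1 := finrank_integralHodgeAnnihilator_add_finrank_integralHodgeClassesIn Φ e h p
  omega

end TranscendentalAllDegrees

end Literature.Geometry.Kaehler.ComplexTorus
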